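import Literature.NumberTheory.GaloisCohomology.Howard2004.TowerDualityReadingCompatProofs
import Literature.NumberTheory.GaloisCohomology.Howard2004.TowerSelmerLiftPairingRightOrthogonalProofs
import HarnessLib

/-!
# Howard 2004, Prop. 1.4.1 — the dual slots `Ψ_j : H¹(K, T^{(j)}) → H¹(K, T^{(j)*})` of two levels are COMPATIBLE:
# `Ψ₀ ∘ H¹(red) = H¹(ι^D) ∘ Ψ_{t+1}`, `Ψ_{t+1} ∘ H¹(ι) = H¹(red^D) ∘ Ψ₀`; RIGHT-orthogonality in `Ψ`-currency — proofs file
# (brick «C451-CL READ-COMPAT (c′) GLOBAL»)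

Topic `NumberTheory/GaloisCohomology/Howard2004`. THEOREMS ONLY: no definition, no named fact, no instance, no notation,
no `sorry`.  Cell `pub/bsd-print-x9` (seat x10b-p1-w8 g12, `--supports stmt-BirchSwinnertonDyer-22642`; print leaf G87 ↦ the
«Flach leaf» C45.1′ / C45.1″).  Sequel of `TowerDualityReadingCompatProofs` (module identities `ι^D ∘ Θ_{t+1} = Θ₀ ∘ red`,
`Θ_{t+1} ∘ ι = red^D ∘ Θ₀`) and `TowerSelmerLiftPairingRightOrthogonalProofs` (Q5-DUAL: the Poitou–Tate value kills `H¹(ι^D)` of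
the level-`t+1` dual Selmer group), for the transfers `Ψ_j` of `ConjugationTwistTransferProofs` (x10b-p1-w7): `Ψ_j[φ] = [Θ_j ∘ φ ∘ τ]`.

SOURCE. B. Howard, *The Heegner point Kolyvagin system*, Compositio Math. **140** (2004) = arXiv:1202.6340, Prop. 1.4.1 and proof
of Thm. 1.4.2 (p0008 L83–124: «we may identify `H¹_{𝓕*}(K, T*[𝔪^k]) ≅ H¹_𝓕(K, T[𝔪^k])`», «on the right the image of `π^s`»);
§1.3 H.4 (p. 7 L69–82); J.-P. Serre, *Galois Cohomology*, I §2.4 (compatible pairs are functorial).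

WHAT IS PROVED (binders of `TowerDualityReadingCompatProofs`: `S hy ι hι lam₀ lam₁ hlam₀ hlam₁ exp hexp hcompat`, then `hιg` and the
two slots `Ψ₀`, `Ψ₁` with their cocycle clauses `hΨ₀`, `hΨ₁` of `exists_conjTransfer` for `Θ₀`, `Θ_{t+1}`).
* §1 **`dualSlot_redLEH1_eq_cohomologyMap_transpose_iota`** `Ψ₀ (H¹(red) c) = H¹(ι^D) (Ψ_{t+1} c)` for `c ∈ H¹(K, T^{(t+1)})` and
  **`dualSlot_cohomologyMap_iota_eq_transpose_red`** `Ψ_{t+1} (H¹(ι) c₀) = H¹(red^D) (Ψ₀ c₀)` for `c₀ ∈ H¹(K, T^{(0)})`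
  (`conjTransfer_cohomologyMap` + the module identities).
* §2 **`sum_localTatePairingZMod_defects_dualSlot_redLEH1_eq_zero`** — RIGHT-orthogonality in `Ψ`-currency: for local defects
  `(m_v)` of a global `ã ∈ H¹(K, T^{(t+1)})` (w.r.t. `ι`, `𝓕(n)_{t+1}`) supported on `Σ`, and `z ∈ H¹(K, T^{(t+1)})` with
  `Ψ_{t+1} z ∈ H¹_{𝓕(n)_{t+1}^*}(K, T^{(t+1)*})` (e.g. `z ∈ 𝓗_{t+1}(n)`): `∑_{v ∈ Σ} inv_v(m_v ∪ loc_v Ψ₀(H¹(red) z)) = 0` — i.e. the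
  class-level value `P(a)(Ψ₀(red z)) = 0`, the `hright_le` clause of the tower entry.

HONEST FRAMING: no pairing is constructed; Prop. 1.4.1, C45.1′/C45.1″ and `thm161_dvrKolyvaginBound` are NOT proved; no summit
statement is proved; the Birch–Swinnerton-Dyer conjecture is not proved by any of this.
-/

set_option autoImplicit false

noncomputable section

namespace Literature.NumberTheory.GaloisCohomology.Howard2004

open Function NumberField IsDedekindDomain Field CategoryTheory
open scoped NumberField ContRepresentation
open Literature.NumberTheory.GaloisRepresentations
open Literature.NumberTheory.GaloisRepresentations.DiscreteGaloisModule
open Literature.NumberTheory.GaloisCohomology (LocalInvariants)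

namespace DVRSetting

variable {p : ℕ} [Fact p.Prime] {K : Type} [Field K] [NumberField K]
  {R : Type} [CommRing R] [IsDomain R] [IsDiscreteValuationRing R] [Algebra ℤ_[p] R]
  {N : ℕ → Type} [∀ k, AddCommGroup (N k)] [∀ k, TopologicalSpace (N k)]
  [∀ k, DiscreteTopology (N k)] [∀ k, Module R (N k)]
  {Rk : ℕ → Type} [∀ k, CommRing (Rk k)] [∀ k, IsLocalRing (Rk k)] [∀ k, TopologicalSpace (Rk k)]
  [∀ k, DiscreteTopology (Rk k)] [∀ k, Algebra ℤ_[p] (Rk k)] [∀ k, Algebra R (Rk k)]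
  [∀ k, Module (Rk k) (N k)] [∀ k, IsScalarTower R (Rk k) (N k)]
  {Nbar : Type} [AddCommGroup Nbar] [TopologicalSpace Nbar] [DiscreteTopology Nbar]
  [∀ k, Module (Rk k) Nbar]
  {Nq : ℕ → Finset (HeightOneSpectrum (𝓞 K)) → Type} [∀ k n, AddCommGroup (Nq k n)]
  [∀ k n, TopologicalSpace (Nq k n)] [∀ k n, DiscreteTopology (Nq k n)]
  [∀ k n, Module (Rk k) (Nq k n)] [∀ k n, Module R (Nq k n)]
  [∀ k n, IsScalarTower R (Rk k) (Nq k n)]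

section Slots

variable [∀ k, Finite (N k)] (S : DVRSetting p K R N Rk Nbar Nq) (hy : S.SatisfiesH) {t : ℕ} (ι : N 0 →ₗ[R] N (t + 1))
  (hι : ∀ y : N (t + 1), ι (S.T.redLE (Nat.zero_le (t + 1)) y) = S.π ^ (S.e (t + 1) - S.e 0) • y)
  (hιg : ∀ (g : absoluteGaloisGroup K) (x : N 0), ι (S.T.ρ 0 g x) = S.T.ρ (t + 1) g (ι x))
  {k' : ℕ} (lam₀ : Rk 0 →+ ZMod (p ^ k')) (lam₁ : Rk (t + 1) →+ ZMod (p ^ k'))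
  (hlam₀ : ∀ (z : ℤ_[p]) (r : Rk 0), lam₀ (algebraMap ℤ_[p] (Rk 0) z * r) = PadicInt.toZModPow k' z * lam₀ r)
  (hlam₁ : ∀ (z : ℤ_[p]) (r : Rk (t + 1)), lam₁ (algebraMap ℤ_[p] (Rk (t + 1)) z * r) = PadicInt.toZModPow k' z * lam₁ r)
  (exp : ZMod (p ^ k') →+ MuCarrier K (p ^ k'))
  (hexp : ∀ (g : absoluteGaloisGroup K) (x : ZMod (p ^ k')), exp (cyclotomicCharacterModPow K p k' g * x) = mu K (p ^ k') g (exp x))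
  (hcompat : ∀ r : R, lam₁ (algebraMap R (Rk (t + 1)) (S.π ^ (S.e (t + 1) - S.e 0) * r)) = lam₀ (algebraMap R (Rk 0) r))
  (Ψ₀ : galoisCohomology (S.T.ρ 0) 1 →+ galoisCohomology ((S.T.ρ 0).tateDual (p ^ k')) 1)
  (hΨ₀ : ∀ (φ : contOneCocycles (S.T.ρ 0).toTopRep) (ψ : contOneCocycles ((S.T.ρ 0).tateDual (p ^ k')).toTopRep),
    (∀ g, ψ.1 g = ((S.D 0).toTateDual lam₀ hlam₀ exp hexp).toContinuousLinearMap.toLinearMap.toAddMonoidHom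
      (φ.1 (S.cd.conj g))) → Ψ₀ (oneCocycleClass _ φ) = oneCocycleClass _ ψ)
  (Ψ₁ : galoisCohomology (S.T.ρ (t + 1)) 1 →+ galoisCohomology ((S.T.ρ (t + 1)).tateDual (p ^ k')) 1)
  (hΨ₁ : ∀ (φ : contOneCocycles (S.T.ρ (t + 1)).toTopRep) (ψ : contOneCocycles ((S.T.ρ (t + 1)).tateDual (p ^ k')).toTopRep),
    (∀ g, ψ.1 g = ((S.D (t + 1)).toTateDual lam₁ hlam₁ exp hexp).toContinuousLinearMap.toLinearMap.toAddMonoidHom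
      (φ.1 (S.cd.conj g))) → Ψ₁ (oneCocycleClass _ φ) = oneCocycleClass _ ψ)

include hy hι hcompat hΨ₀ hΨ₁

/-! ## §1 The slots commute with `H¹(red)` / `H¹(ι)` up to the transposes -/

/-- **`Ψ₀ ∘ H¹(red) = H¹(ι^D) ∘ Ψ_{t+1}`** on `H¹(K, T^{(t+1)})`: the transfers of two levels are compatible along the reduction,
the transpose `ι^D` appearing on the dual side (`conjTransfer_cohomologyMap` with `ι^D ∘ Θ_{t+1} = Θ₀ ∘ red`).
[cite: Howard2004HeegnerKolyvagin, Prop. 1.4.1 and Thm. 1.4.2 proof (arXiv:1202.6340 p0008 L83–124), H.4 (p. 7 L69–82)]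
[cite: SerreGaloisCohomology1997, Ch. I §2.4 (compatible pairs)] -/
theorem dualSlot_redLEH1_eq_cohomologyMap_transpose_iota (c : galoisCohomology (S.T.ρ (t + 1)) 1) :
    Ψ₀ (S.redLEH1 (Nat.zero_le (t + 1)) c) =
      ContinuousRep.cohomologyMap ((S.T.ρ (t + 1)).tateDual (p ^ k')) ((S.T.ρ 0).tateDual (p ^ k'))
        (pairingDualHom (p ^ k') ((tateDualEval K (N (t + 1)) (p ^ k')).comp ι.toAddMonoidHom)) continuous_of_discreteTopology
        (pairingDualHom_smul (S.pairing_transpose_smul (p ^ k') ι hιg)) 1 (Ψ₁ c) := by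
  rw [S.redLEH1_apply]
  exact conjTransfer_cohomologyMap S.cd (S.T.ρ (t + 1)) (S.T.ρ 0) ((S.T.ρ (t + 1)).tateDual (p ^ k'))
    ((S.T.ρ 0).tateDual (p ^ k')) (S.T.redLE (Nat.zero_le (t + 1))).toAddMonoidHom
    (S.T.redLE_equivariant (Nat.zero_le (t + 1))) _
    (pairingDualHom_smul (S.pairing_transpose_smul (p ^ k') ι hιg)) _ ((S.D (t + 1)).toTateDual_semilinear lam₁ hlam₁ exp hexp)
    _ ((S.D 0).toTateDual_semilinear lam₀ hlam₀ exp hexp)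
    (fun x => (S.transpose_iota_toTateDual_eq hy ι hι lam₀ lam₁ hlam₀ hlam₁ exp hexp hcompat x).symm) Ψ₁ hΨ₁ Ψ₀ hΨ₀ c

/-- **`Ψ_{t+1} ∘ H¹(ι) = H¹(red^D) ∘ Ψ₀`** on `H¹(K, T^{(0)})` (`conjTransfer_cohomologyMap` with `Θ_{t+1} ∘ ι = red^D ∘ Θ₀`).
[cite: Howard2004HeegnerKolyvagin, Prop. 1.4.1 and Thm. 1.4.2 proof (arXiv:1202.6340 p0008 L83–124), H.4 (p. 7 L69–82)]
[cite: SerreGaloisCohomology1997, Ch. I §2.4 (compatible pairs)] -/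
theorem dualSlot_cohomologyMap_iota_eq_transpose_red (c₀ : galoisCohomology (S.T.ρ 0) 1) :
    Ψ₁ (ContinuousRep.cohomologyMap (S.T.ρ 0) (S.T.ρ (t + 1)) ι.toAddMonoidHom continuous_of_discreteTopology hιg 1 c₀) =
      ContinuousRep.cohomologyMap ((S.T.ρ 0).tateDual (p ^ k')) ((S.T.ρ (t + 1)).tateDual (p ^ k'))
        (pairingDualHom (p ^ k') ((tateDualEval K (N 0) (p ^ k')).comp (S.T.redLE (Nat.zero_le (t + 1))).toAddMonoidHom))
        continuous_of_discreteTopology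
        (pairingDualHom_smul (pairing_comp_smul (S.T.ρ (t + 1)) (S.T.ρ 0) (p ^ k')
          (S.T.redLE (Nat.zero_le (t + 1))).toAddMonoidHom (S.T.redLE_equivariant (Nat.zero_le (t + 1))))) 1 (Ψ₀ c₀) :=
  conjTransfer_cohomologyMap S.cd (S.T.ρ 0) (S.T.ρ (t + 1)) ((S.T.ρ 0).tateDual (p ^ k'))
    ((S.T.ρ (t + 1)).tateDual (p ^ k')) ι.toAddMonoidHom hιg _
    (pairingDualHom_smul (pairing_comp_smul (S.T.ρ (t + 1)) (S.T.ρ 0) (p ^ k')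
      (S.T.redLE (Nat.zero_le (t + 1))).toAddMonoidHom (S.T.redLE_equivariant (Nat.zero_le (t + 1)))))
    _ ((S.D 0).toTateDual_semilinear lam₀ hlam₀ exp hexp) _ ((S.D (t + 1)).toTateDual_semilinear lam₁ hlam₁ exp hexp)
    (fun s => S.toTateDual_iota_eq_transpose_red hy ι hι lam₀ lam₁ hlam₀ hlam₁ exp hexp hcompat s) Ψ₀ hΨ₀ Ψ₁ hΨ₁ c₀

/-! ## §2 RIGHT-orthogonality in `Ψ`-currency -/

/-- **`P(a)(Ψ₀(red z)) = 0`: the class-level Poitou–Tate value kills `Ψ₀` of the reductions of level-`t+1` classes whose transfer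
is dual-Selmer** — for local defects `(m_v)` of a global `ã` (`loc_v ã - ℓ_v = H¹_v(ι) m_v`, `ℓ_v ∈ 𝓕(n)_{t+1,v}`, supported on `Σ`),
the reciprocity law for `inv`, and `z ∈ H¹(K, T^{(t+1)})` with `Ψ_{t+1} z ∈ H¹_{𝓕(n)_{t+1}^*}(K, T^{(t+1)*})`:
`∑_{v ∈ Σ} inv_v(m_v ∪ loc_v Ψ₀(H¹(red) z)) = 0` (§1, then Q5-DUAL `sum_localTatePairingZMod_defects_transpose_eq_zero`).  This is the
inclusion «`π 𝓗_{t+1}(n) ⊆` right kernel» of Prop. 1.4.1 read through Howard's identification `H¹_{𝓕*} ≅ H¹_𝓕`.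
[cite: Howard2004HeegnerKolyvagin, Prop. 1.4.1 (arXiv:1202.6340 p0008 L83–98) and Thm. 1.4.2 proof (L120–124)]
[cite: MilneADT2006, Ch. I, Thm. 4.10] -/
theorem sum_localTatePairingZMod_defects_dualSlot_redLEH1_eq_zero (n : Finset (HeightOneSpectrum (𝓞 K)))
    (hM : ∀ x : N (t + 1), (p ^ k') • x = 0) (inv : LocalInvariants K (p ^ k')) (hPT : inv.SumLocalTermEqZero)
    (Sfin : Finset (Place K)) (ã : galoisCohomology (S.T.ρ (t + 1)) 1)
    (m : ∀ v : Place K, galoisCohomology ((S.T.ρ 0).toLocal v) 1)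
    (hm : ∀ v, ∃ ℓ ∈ ((S.t (t + 1)).atLevel S.jbar n).cond v,
      galoisCohomology.localization (S.T.ρ (t + 1)) v 1 ã - ℓ =
        ContinuousRep.cohomologyMap ((S.T.ρ 0).toLocal v) ((S.T.ρ (t + 1)).toLocal v) ι.toAddMonoidHom
          continuous_of_discreteTopology (fun _ x => hιg _ x) 1 (m v))
    (hmS : ∀ v ∉ Sfin, m v = 0) (z : galoisCohomology (S.T.ρ (t + 1)) 1)
    (hΨz : Ψ₁ z ∈ (inv.dualSelmerStructure (S.T.ρ (t + 1)) ((S.t (t + 1)).atLevel S.jbar n).cond).selmerGroup) :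
    haveI : NeZero (p ^ k') := ⟨pow_ne_zero _ (Fact.out : p.Prime).ne_zero⟩
    ∑ v ∈ Sfin, localTatePairingZMod (S.T.ρ 0) (p ^ k') v (inv v) (m v)
        (galoisCohomology.localization ((S.T.ρ 0).tateDual (p ^ k')) v 1 (Ψ₀ (S.redLEH1 (Nat.zero_le (t + 1)) z))) = 0 := by
  haveI : NeZero (p ^ k') := ⟨pow_ne_zero _ (Fact.out : p.Prime).ne_zero⟩
  rw [S.dualSlot_redLEH1_eq_cohomologyMap_transpose_iota hy ι hι hιg lam₀ lam₁ hlam₀ hlam₁ exp hexp hcompat Ψ₀ hΨ₀ Ψ₁ hΨ₁ z]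
  exact S.sum_localTatePairingZMod_defects_transpose_eq_zero n ι hιg hM inv hPT Sfin ã m hm hmS hΨz

end Slots

end DVRSetting

end Literature.NumberTheory.GaloisCohomology.Howard2004

end
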